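import Literature.Topology.FourManifolds.DehnSurgeryTubularUniqueness
import Literature.Topology.FourManifolds.LinkSurgeryUniqueness
import HarnessLib

/-!
# Uniqueness of integral Dehn surgery on a knot: `nonempty_diffeomorph_of_isIntegralSurgery_holds`

Sibling proof file of `DehnSurgery.lean` (D-0014: named facts `def X : Prop` are discharged as
`theorem X_holds : X`). It discharges

* `Literature.Topology.FourManifolds.nonempty_diffeomorph_of_isIntegralSurgery_holds :
    nonempty_diffeomorph_of_isIntegralSurgery` — **uniqueness of Dehn surgery**: two `m`-surgeries
  `Y`, `Y'` (`C^∞` manifolds on arbitrary real models, in arbitrary universes) on isotopic knots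
  `K`, `K'` in `S³` are diffeomorphic (Gompf–Stipsicz, *4-Manifolds and Kirby Calculus* (1999),
  §5.3; Rolfsen, *Knots and Links* (1976), §9.F–G: the surgered manifold depends only on the knot
  type and the framing integer; Kosinski, *Differential Manifolds* (1993), VI.1).

## Proof

With the relational definition of `DehnSurgery.lean` (`IsIntegralSurgery IY Y K m`: `Y` is an open
gluing of the knot complement `S³ ∖ K` and the open solid torus `D̊² × 𝕊¹` along `surgeryRel ν`
for an oriented tubular neighbourhood `ν` of `K` of framing `m`) the printed argument becomes:

1. *Knot type.* Surgery is transported along ambient isotopies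
   (`IsIntegralSurgery.of_isIsotopic_holds`, `KirbyMovesIsotopyProofs.lean`), so `Y` is also an
   `m`-surgery on `K'`; we may assume `K = K'`.
2. *Framing.* Two oriented tubular neighbourhoods `ν₁`, `ν₂` of `K` with the same framing integer
   agree on the unit disc bundle after a diffeomorphism `F` of `S³` fixing `K` pointwise
   (`Knot.TubularNbhd.exists_diffeomorph_eq_of_hasFraming`, `DehnSurgeryTubularUniqueness.lean`:
   uniqueness of tubular neighbourhoods, Kosinski III.(3.5), plus the framing calculus).
3. *Presentation change* (`IsOpenGluing.surgeryRel_of_diffeomorph`, proved here): precomposing the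
   embedding of the knot complement with `F⁻¹|_{S³ ∖ K}` turns a gluing of `Y` along `surgeryRel ν₁`
   into a gluing along `surgeryRel ν₂` (the surgery relation only involves `ν (u, t • v)` with
   `0 < t < 1`, `‖v‖ = 1`).
4. *Uniqueness of open gluings* (the one-handle case `ι = Unit` of
   `nonempty_diffeomorph_of_multiGluing`, `LinkSurgeryUniqueness.lean`, which — unlike
   `IsOpenGluing.nonempty_diffeomorph` of `GluingUniqueness.lean` — allows two model vector spaces;
   Kosinski VI.1, proof of (1.1): "the unique structure for which the projections are
   diffeomorphisms"): two manifolds glued from the same pieces along the same relation are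
   diffeomorphic, for any two models and universes.

## References

* R. E. Gompf, A. I. Stipsicz, *4-Manifolds and Kirby Calculus*, GSM 20 (1999), §5.3.
  [cite: GompfStipsicz1999, §5.3]
* D. Rolfsen, *Knots and Links*, Publish or Perish (1976), §9.F–G. [cite: Rolfsen1976, §9.F]
* A. A. Kosinski, *Differential Manifolds*, Academic Press (1993), Ch. III Thm. (3.5), Ch. VI §1.
  [cite: Kosinski1993, Ch. VI §1, proof of Thm (1.1)]

## Design notes

* No definition is introduced (the restriction of `F⁻¹` to the knot complement is built inside the
  proof, pattern of the tree's `Link.complDiffeoSymm` / `Knot.isoComplDiffeo`); no local notation,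
  no local instances.
* No declaration in this file uses `sorry`; `nonempty_diffeomorph_of_isIntegralSurgery_holds`
  depends only on the axioms `propext`, `Classical.choice`, `Quot.sound`.
-/

noncomputable section

open scoped Manifold ContDiff Topology
open Function Set

namespace Literature.Topology.FourManifolds

section PresentationChange

variable {EY HY : Type*} [NormedAddCommGroup EY] [NormedSpace ℝ EY] [TopologicalSpace HY]
  {IY : ModelWithCorners ℝ EY HY} {Y : Type*} [TopologicalSpace Y] [ChartedSpace HY Y]

/-- **The surgery relation is unchanged by an ambient diffeomorphism matching the tubes.** If `F`
is a diffeomorphism of `S³` with `F (ν₁ (x, w)) = ν₂ (x, w)` for `‖w‖ < 1`, then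
`surgeryRel ν₁ (F⁻¹ a) b ↔ surgeryRel ν₂ a b` — the relation only involves the points `ν (u, t • v)`
with `0 < t < 1`, `‖v‖ = 1` (Rolfsen (1976), §9.F; Kosinski (1993), VI.1: a gluing only depends on
the identification of the glued open sets). [folklore] -/
theorem Knot.TubularNbhd.glueRel_symm_apply_iff {K : Knot} {ν₁ ν₂ : Knot.TubularNbhd K}
    (F : (Metric.sphere (0 : EuclideanSpace ℝ (Fin 4)) 1) ≃ₘ⟮𝓡 3, 𝓡 3⟯
      (Metric.sphere (0 : EuclideanSpace ℝ (Fin 4)) 1))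
    (hF : ∀ (x : Metric.sphere (0 : EuclideanSpace ℝ (Fin 2)) 1) (w : EuclideanSpace ℝ (Fin 2)),
      ‖w‖ < 1 → F (ν₁ (x, w)) = ν₂ (x, w))
    (a : Metric.sphere (0 : EuclideanSpace ℝ (Fin 4)) 1)
    (b : EuclideanSpace ℝ (Fin 2) × Metric.sphere (0 : EuclideanSpace ℝ (Fin 2)) 1) :
    ν₁.glueRel (F.symm a) b ↔ ν₂.glueRel a b := by
  have hnorm : ∀ t ∈ Ioo (0 : ℝ) 1, ‖t • ((b.2 : Metric.sphere (0 : EuclideanSpace ℝ (Fin 2)) 1) :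
      EuclideanSpace ℝ (Fin 2))‖ < 1 := fun t ht => by
    rw [norm_smul, norm_eq_of_mem_sphere, mul_one, Real.norm_of_nonneg ht.1.le]
    exact ht.2
  constructor
  · rintro ⟨u, t, ht, hb, ha⟩
    refine ⟨u, t, ht, hb, ?_⟩
    rw [← hF _ _ (hnorm t ht), ← ha, Diffeomorph.apply_symm_apply]
  · rintro ⟨u, t, ht, hb, ha⟩
    refine ⟨u, t, ht, hb, ?_⟩
    rw [← (F.symm_apply_apply (ν₁ (u, t • _))), hF _ _ (hnorm t ht), ← ha]

/-- **Presentation change for Dehn surgery.** Let `Y` be an open gluing of the knot complement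
`S³ ∖ K` and the open solid torus along the surgery relation `surgeryRel ν₁` of an oriented tubular
neighbourhood `ν₁` of `K`, and let `F` be a diffeomorphism of `S³` fixing `K` pointwise with
`F (ν₁ (x, w)) = ν₂ (x, w)` for `‖w‖ < 1`. Then `Y` is an open gluing of the same pieces along
`surgeryRel ν₂`: precompose the embedding of the knot complement with the restriction of `F⁻¹` to
`S³ ∖ K` (a diffeomorphism of the open submanifold, as `F` fixes `K`; a smooth embedding after a
diffeomorphism is a smooth embedding, `Manifold.IsSmoothEmbedding.comp_diffeomorph`) and keep the
solid torus. Kosinski (1993), VI.1 (transport of gluings along diffeomorphisms of the pieces);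
Rolfsen (1976), §9.F. [cite: Kosinski1993, Ch. VI §1, proof of Thm (1.1)] -/
theorem IsOpenGluing.surgeryRel_of_diffeomorph {K : Knot} {ν₁ ν₂ : Knot.TubularNbhd K}
    (hG : IsOpenGluing (𝓡 3) (𝓘(ℝ, EuclideanSpace ℝ (Fin 2)).prod (𝓡 1)) IY (A := K.complement)
      (B := solidTorus) (P := Y) (surgeryRel ν₁))
    (F : (Metric.sphere (0 : EuclideanSpace ℝ (Fin 4)) 1) ≃ₘ⟮𝓡 3, 𝓡 3⟯
      (Metric.sphere (0 : EuclideanSpace ℝ (Fin 4)) 1))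
    (hK : ∀ x, F (K x) = K x)
    (hF : ∀ (x : Metric.sphere (0 : EuclideanSpace ℝ (Fin 2)) 1) (w : EuclideanSpace ℝ (Fin 2)),
      ‖w‖ < 1 → F (ν₁ (x, w)) = ν₂ (x, w)) :
    IsOpenGluing (𝓡 3) (𝓘(ℝ, EuclideanSpace ℝ (Fin 2)).prod (𝓡 1)) IY (A := K.complement)
      (B := solidTorus) (P := Y) (surgeryRel ν₂) := by
  obtain ⟨jA, jB, hA, hAo, hB, hBo, hU, hR⟩ := hG
  -- `F` and `F⁻¹` preserve the knot complement
  have hmem : ∀ a : K.complement, F a ∈ K.complement := fun a => by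
    rw [SphereEmbedding.mem_complement_iff]
    rintro ⟨y, hy⟩
    rw [← hK] at hy
    exact a.2 ⟨y, F.injective hy⟩
  have hmem' : ∀ a : K.complement, F.symm a ∈ K.complement := fun a => by
    rw [SphereEmbedding.mem_complement_iff]
    rintro ⟨y, hy⟩
    have hy' : F (K y) = a := by rw [hy, Diffeomorph.apply_symm_apply]
    rw [hK] at hy'
    exact a.2 ⟨y, hy'⟩
  -- the restriction of `F⁻¹` to the complement, a diffeomorphism of the open submanifold
  let Φ : K.complement ≃ₘ⟮𝓡 3, 𝓡 3⟯ K.complement :=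
    { toFun := fun a => ⟨F.symm a, hmem' a⟩
      invFun := fun a => ⟨F a, hmem a⟩
      left_inv := fun a => Subtype.ext (F.apply_symm_apply _)
      right_inv := fun a => Subtype.ext (F.symm_apply_apply _)
      contMDiff_toFun := (ContMDiff.subtypeVal_comp_iff K.complement _).1
        (F.symm.contMDiff.comp contMDiff_subtype_val)
      contMDiff_invFun := (ContMDiff.subtypeVal_comp_iff K.complement _).1
        (F.contMDiff.comp contMDiff_subtype_val) }
  have hΦ : ∀ a : K.complement, ((Φ a : K.complement) : Metric.sphere (0 : EuclideanSpace ℝ (Fin 4)) 1) =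
      F.symm a := fun a => rfl
  have hrange : range (jA ∘ Φ) = range jA := (EquivLike.surjective Φ).range_comp jA
  refine ⟨jA ∘ Φ, jB, hA.comp_diffeomorph Φ, by rwa [hrange], hB, hBo, by rwa [hrange],
    fun a b => ?_⟩
  rw [comp_apply, hR (Φ a) b]
  change ν₁.glueRel ((Φ a : K.complement) : Metric.sphere (0 : EuclideanSpace ℝ (Fin 4)) 1) _ ↔
    ν₂.glueRel (a : Metric.sphere (0 : EuclideanSpace ℝ (Fin 4)) 1) _
  rw [hΦ]
  exact Knot.TubularNbhd.glueRel_symm_apply_iff F hF _ _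

/-- **Integral surgery presented with another tubular neighbourhood of the same framing.** If
`Y` is an open gluing along `surgeryRel ν₁` and `ν₂` is another oriented tubular neighbourhood of
the same knot with the same framing integer, then `Y` is an open gluing along `surgeryRel ν₂`
(`Knot.TubularNbhd.exists_diffeomorph_eq_of_hasFraming` and the presentation change).
Gompf–Stipsicz (1999), §5.3; Rolfsen (1976), §9.F. [cite: GompfStipsicz1999, §5.3] -/
theorem IsOpenGluing.surgeryRel_of_hasFraming {K : Knot} {m : ℤ} {ν₁ ν₂ : Knot.TubularNbhd K}
    (hG : IsOpenGluing (𝓡 3) (𝓘(ℝ, EuclideanSpace ℝ (Fin 2)).prod (𝓡 1)) IY (A := K.complement)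
      (B := solidTorus) (P := Y) (surgeryRel ν₁))
    (h₁ : ν₁.HasFraming m) (h₂ : ν₂.HasFraming m) :
    IsOpenGluing (𝓡 3) (𝓘(ℝ, EuclideanSpace ℝ (Fin 2)).prod (𝓡 1)) IY (A := K.complement)
      (B := solidTorus) (P := Y) (surgeryRel ν₂) := by
  obtain ⟨F, hFK, hF⟩ := Knot.TubularNbhd.exists_diffeomorph_eq_of_hasFraming ν₁ ν₂ h₁ h₂
  exact hG.surgeryRel_of_diffeomorph F hFK hF

end PresentationChange

section Uniqueness

variable {EY HY : Type*} [NormedAddCommGroup EY] [NormedSpace ℝ EY] [TopologicalSpace HY]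
  {IY : ModelWithCorners ℝ EY HY} {Y : Type*} [TopologicalSpace Y] [ChartedSpace HY Y]

/-- **Uniqueness of Dehn surgery** — discharge of the named fact
`Literature.Topology.FourManifolds.nonempty_diffeomorph_of_isIntegralSurgery` of `DehnSurgery.lean`: two `m`-surgeries
`Y`, `Y'` (`C^∞` manifolds, possibly on different real models and in different universes) on
isotopic knots `K`, `K'` are diffeomorphic. Transport the surgery description of `Y` from `K` to
`K'` along the ambient isotopy (`IsIntegralSurgery.of_isIsotopic_holds`), re-present it with the
tubular neighbourhood used for `Y'` (`IsOpenGluing.surgeryRel_of_hasFraming`: same framing integer,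
so the two oriented tubular neighbourhoods agree on the unit disc bundle after an ambient
diffeomorphism fixing the knot), and conclude by the uniqueness of open gluings
(`nonempty_diffeomorph_of_multiGluing` with one handle, Kosinski VI.1). Gompf–Stipsicz, *4-Manifolds and Kirby
Calculus* (1999), §5.3; Rolfsen, *Knots and Links* (1976), §9.F–G; Kosinski, *Differential
Manifolds* (1993), III.(3.5), VI.1. [cite: GompfStipsicz1999, §5.3] -/
theorem nonempty_diffeomorph_of_isIntegralSurgery_holds :
    nonempty_diffeomorph_of_isIntegralSurgery (IY := IY) (Y := Y) := by
  intro _ EY' HY' _ _ _ IY' Y' _ _ _ K K' m hK h h'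
  obtain ⟨ν₁, hν₁, hG₁⟩ := IsIntegralSurgery.of_isIsotopic_holds h hK
  obtain ⟨ν₂, hν₂, hG₂⟩ := h'
  -- both `Y` and `Y'` are open gluings along `surgeryRel ν₂`; uniqueness of open gluings for two
  -- models (the one-handle case `ι = Unit` of `nonempty_diffeomorph_of_multiGluing`)
  obtain ⟨jA, jB, hA, hAo, hB, hBo, hU, hR⟩ := hG₁.surgeryRel_of_hasFraming hν₁ hν₂
  obtain ⟨jA', jB', hA', hAo', hB', hBo', hU', hR'⟩ := hG₂
  refine nonempty_diffeomorph_of_multiGluing (ι := Unit) (jB := fun _ => jB) (jB' := fun _ => jB')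
    (R := fun _ => surgeryRel ν₂) hA hAo (fun _ => ⟨hB, hBo⟩) (by rwa [iUnion_const])
    (fun i j hij => absurd (Subsingleton.elim i j) hij) (fun _ a b => hR a b) hA' hAo'
    (fun _ => ⟨hB', hBo'⟩) (by rwa [iUnion_const]) (fun i j hij => absurd (Subsingleton.elim i j) hij)
    fun _ a b => hR' a b

end Uniqueness

end Literature.Topology.FourManifolds
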